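/-
Origin: expansion seat `planner-pub-hodgecm-toy-g2-0`, handover #18 2026-08-18T08:18:34Z (`HOME/pub-hodgecm-toy-g2/lean/ToyG2/Universe3.lean`, md5 6a753c1b, 301 lines);
landed by the gen-7 packager in gate run 26 as `HodgeCM/Model/ToyG2/Universe3.lean` (import ^import ToyG2\.→import HodgeCM.Model.ToyG2. ×2).
-/
/-
# HodgeCM.Model.ToyG2.Universe3 — the generation-2 universe restricted to GOOD objects

Generation 2 of the `pub-hodgecm-toy` lineage (seat `planner-pub-hodgecm-toy-g2-0`), DESIGN.md §9.

`NoGysin.lean` refutes M26 on the object class `Obj₂` of `Universe2.lean` (blocks with zero trace are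
admitted); `Good.lean` isolates the **good** objects (every block leaf has nonzero trace of Hodge type
(2,2)) and proves that the period leaves `P(L, ι₁)` are good.  This file builds the universe
`toyModel3With D T pl` with

* `Var := GObj` = good objects, `prod`, `cmAV := cmObj₂`, `pms := pbObj (pl L ι₁)` (good by hypothesis),
* every other field = the corresponding field of `toyModel2With` on the underlying `Obj₂`,

re-proves the 27 axioms M1–M25, M27, M28 on it (verbatim transfers of `Universe2` / `Axioms2`), and
specialises to **`toyUniverse₃ d t := toyModel3With exteriorHodgeData traceSys (gplOf d t)`** on the period
leaves: `toyUniverse₃_modelAxioms_of_gysin` (27/28, M26 displayed), `toyUniverse₃_tr_pms_ne_zero`, and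
`toyUniverse₃_good` (the `NoGysin` witness is not a variety of this universe).  The Gysin leg G1–G3 of
DESIGN.md §8–§9 is the remaining work.
-/
import Mathlib
import Summits.HodgeConjecture.HodgeCM.Model.ToyG2.Axioms2
import Summits.HodgeConjecture.HodgeCM.Model.ToyG2.Good

namespace HodgeCM.ToyG2

open HodgeCM.Toy HodgeCM.Toy.CMPresentation
open Literature.AlgebraicGeometry.Motives
open Literature.AlgebraicGeometry.Motives.HodgeStructure (EndAction conj ofRat mem_hodgeClasses_iff)
open scoped TensorProduct
open exteriorPower Obj₂

noncomputable section

/-! ### Good objects and good block assignments -/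

/-- a **good object**: a generation-2 object all of whose block leaves have nonzero trace of type (2,2) -/
structure GObj : Type where
  /-- the underlying generation-2 object -/
  X : Obj₂
  good : X.Good

namespace GObj

/-- product of good objects -/
@[reducible] def prod (X Y : GObj) : GObj := ⟨X.X.prod Y.X, X.good.prod Y.good⟩

/-- the CM object `A_{(K,Φ)}` (block-free, hence good) -/
@[reducible] def cm (K : CMField) (Φ : CMType K) : GObj := ⟨cmObj₂ K Φ, good_cmObj₂ K Φ⟩

/-- a good Picard block as a good object -/
@[reducible] def pb (p : PLeaf) (h : (Leaf.pb p).Good) : GObj := ⟨pbObj p, good_pbObj h⟩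

end GObj

/-- a **good block assignment**: a period leaf per `(L, ι₁)`, each good -/
structure GBlocks : Type 1 where
  pl : PBlocks
  good : ∀ (L : CMField) (ι₁ : L →+* ℂ), (Leaf.pb (pl L ι₁)).Good

/-! ### The universe on good objects -/

/-- **The generation-2 toy universe on good objects** (reducible, so that its fields compute). -/
@[reducible] def toyModel3With (D : HodgeData) (T : TraceSys) (pl : GBlocks) : Universe where
  Var := GObj
  dim X := X.X.dim
  Coh X k := ↥(⋀[ℚ]^k X.X.L)
  hodge X k := D.hs X.X.toObj k
  alg X p := (D.hs X.X.toObj (2 * p)).hodgeClasses (p : ℤ)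
  Mor X Y := Obj₂.Hom₂ X.X Y.X
  idMor X := Obj₂.Hom₂.id X.X
  comp f g := f.comp g
  pull f k := map k f.lin
  cup X i j := wedge ℚ X.X.L i j
  tr X k := T.tr X.X k
  prod := GObj.prod
  fst X Y := Obj₂.Hom₂.fst X.X Y.X
  snd X Y := Obj₂.Hom₂.snd X.X Y.X
  IsAbelianVariety X := X.X.IsBlockFree
  IsCMAbelianVariety X := ∃ (K : CMField) (Φ : CMType K), X = GObj.cm K Φ
  cmAV := GObj.cm
  cmAct K Φ := cmAction K Φ D
  pms L ι₁ _ _ := GObj.pb (pl.pl L ι₁) (pl.good L ι₁)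

variable (D : HodgeData) (T : TraceSys) (pl : GBlocks)

/-! ### Unfolding lemmas (all `rfl`) -/
section unfold
variable {D T pl}
variable {X Y Z : GObj}

/-- (Ported verbatim from the HodgeCMPerL package; no docstring in the source.) -/
lemma Var₃_eq : (toyModel3With D T pl).Var = GObj := rfl
/-- (Ported verbatim from the HodgeCMPerL package; no docstring in the source.) -/
lemma pull₃_eq (f : Hom₂ X.X Y.X) (k : ℕ) :
    (toyModel3With D T pl).pull (X := X) (Y := Y) f k = map k f.lin := rfl
/-- (Ported verbatim from the HodgeCMPerL package; no docstring in the source.) -/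
lemma comp₃_eq (f : Hom₂ X.X Y.X) (g : Hom₂ Y.X Z.X) :
    (toyModel3With D T pl).comp (X := X) (Y := Y) (Z := Z) f g = f.comp g := rfl
/-- (Ported verbatim from the HodgeCMPerL package; no docstring in the source.) -/
lemma cup₃_eq (X : GObj) (i j : ℕ) : (toyModel3With D T pl).cup X i j = wedge ℚ X.X.L i j := rfl
/-- (Ported verbatim from the HodgeCMPerL package; no docstring in the source.) -/
lemma tr₃_eq (X : GObj) (k : ℕ) : (toyModel3With D T pl).tr X k = T.tr X.X k := rfl
/-- (Ported verbatim from the HodgeCMPerL package; no docstring in the source.) -/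
lemma alg₃_eq (X : GObj) (p : ℕ) :
    (toyModel3With D T pl).alg X p = (D.hs X.X.toObj (2 * p)).hodgeClasses (p : ℤ) := rfl
/-- (Ported verbatim from the HodgeCMPerL package; no docstring in the source.) -/
lemma dim₃_eq (X : GObj) : (toyModel3With D T pl).dim X = X.X.dim := rfl
/-- (Ported verbatim from the HodgeCMPerL package; no docstring in the source.) -/
lemma cmAV₃_X (K : CMField) (Φ : CMType K) : ((toyModel3With D T pl).cmAV K Φ).X = cmObj₂ K Φ := rfl
/-- (Ported verbatim from the HodgeCMPerL package; no docstring in the source.) -/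
lemma pms₃_X (L : CMField) (ι₁ : L →+* ℂ) (V : HermSpace3 L ι₁) (Γ : Level V) :
    ((toyModel3With D T pl).pms L ι₁ V Γ).X = pbObj (pl.pl L ι₁) := rfl
/-- the fourfold product of CM objects has the same underlying object as in `toyModel2With` -/
lemma prod4₃_X (K : CMField) (Φ : Fin 4 → CMType K) :
    ((toyModel3With D T pl).prod4 K Φ).X = (toyModel2With D T pl.pl).prod4 K Φ := rfl
/-- (Ported verbatim from the HodgeCMPerL package; no docstring in the source.) -/
lemma toObj_prod4₃ (K : CMField) (Φ : Fin 4 → CMType K) :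
    ((toyModel3With D T pl).prod4 K Φ).X.toObj = (toyModelWith D).prod4 K Φ := rfl
/-- (Ported verbatim from the HodgeCMPerL package; no docstring in the source.) -/
lemma pr4₃_hom (K : CMField) (Φ : Fin 4 → CMType K) (i : Fin 4) :
    ((toyModel3With D T pl).pr4 K Φ i).hom = (toyModelWith D).pr4 K Φ i := by
  fin_cases i <;> rfl
/-- **every variety of the restricted universe is good** -/
lemma var₃_good (X : (toyModel3With D T pl).Var) : X.X.Good := X.good

end unfold

/-! ### M1–M10 -/

/-- (Ported verbatim from the HodgeCMPerL package; no docstring in the source.) -/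
theorem fact3_pull_id : (toyModel3With D T pl).Fact_pull_id := fun _ _ => map_id

/-- (Ported verbatim from the HodgeCMPerL package; no docstring in the source.) -/
theorem fact3_pull_comp : (toyModel3With D T pl).Fact_pull_comp := fun _ _ _ _ _ _ => map_comp _ _

/-- (Ported verbatim from the HodgeCMPerL package; no docstring in the source.) -/
theorem fact3_pull_cup : (toyModel3With D T pl).Fact_pull_cup := fun _ _ f i j x y =>
  map_wedge i j f.lin x y

/-- (Ported verbatim from the HodgeCMPerL package; no docstring in the source.) -/
theorem fact3_pull_hodge : (toyModel3With D T pl).Fact_pull_hodge := fun _ _ f k p => D.natural f.hom k p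

/-- (Ported verbatim from the HodgeCMPerL package; no docstring in the source.) -/
theorem fact3_cup2_hodge : (toyModel3With D T pl).Fact_cup2_hodge := fun X k p q x y hx hy =>
  D.mul X.X.toObj k p q x y hx hy

/-- (Ported verbatim from the HodgeCMPerL package; no docstring in the source.) -/
theorem fact3_tr_degree : (toyModel3With D T pl).Fact_tr_degree := fun X k hk => T.degree X.X k hk

/-- (Ported verbatim from the HodgeCMPerL package; no docstring in the source.) -/
theorem fact3_alg_le_hodge : (toyModel3With D T pl).Fact_alg_le_hodge := fun _ _ => le_rfl

/-- (Ported verbatim from the HodgeCMPerL package; no docstring in the source.) -/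
theorem fact3_lefschetz11 : (toyModel3With D T pl).Fact_Lefschetz11 := fun _ => le_rfl

/-- (Ported verbatim from the HodgeCMPerL package; no docstring in the source.) -/
theorem fact3_pull_alg : (toyModel3With D T pl).Fact_pull_alg := by
  intro X Y f p v hv
  obtain ⟨w, hw, rfl⟩ := Submodule.mem_map.mp hv
  change w ∈ (D.hs Y.X.toObj (2 * p)).hodgeClasses (p : ℤ) at hw
  change map (2 * p) f.lin w ∈ (D.hs X.X.toObj (2 * p)).hodgeClasses (p : ℤ)
  rw [mem_hodgeClasses_iff] at hw ⊢
  refine D.natural f.hom (2 * p) p ⟨ofRat w, hw, ?_⟩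
  simp [LinearMap.baseChange_tmul]

/-- (Ported verbatim from the HodgeCMPerL package; no docstring in the source.) -/
theorem fact3_cup_alg : (toyModel3With D T pl).Fact_cup_alg := by
  intro X x y hx hy
  change x ∈ (D.hs X.X.toObj (2 * 1)).hodgeClasses ((1 : ℕ) : ℤ) at hx
  change y ∈ (D.hs X.X.toObj (2 * 1)).hodgeClasses ((1 : ℕ) : ℤ) at hy
  change wedge ℚ X.X.L 2 2 x y ∈ (D.hs X.X.toObj (2 * 2)).hodgeClasses ((2 : ℕ) : ℤ)
  rw [mem_hodgeClasses_iff] at hx hy ⊢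
  have h := D.mul X.X.toObj 2 1 1 (ofRat x) (ofRat y) hx hy
  have e : LinearMap.BilinMap.baseChange ℂ (wedge ℚ X.X.L 2 2) (ofRat x) (ofRat y)
      = ofRat (wedge ℚ X.X.L 2 2 x y) := by
    simp [LinearMap.BilinMap.baseChange_tmul]
  rw [e] at h
  simpa using h

/-! ### M14, the surface dimension, M18–M24 -/

/-- (Ported verbatim from the HodgeCMPerL package; no docstring in the source.) -/
theorem fact3_cmAV : (toyModel3With D T pl).Fact_cmAV := fun K Φ =>
  ⟨isBlockFree_cmObj₂ K Φ, ⟨K, Φ, rfl⟩, dim_cmObj₂ K Φ⟩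

/-- (Ported verbatim from the HodgeCMPerL package; no docstring in the source.) -/
theorem fact3_pms_dim : (toyModel3With D T pl).PmsDimTwo := fun L ι₁ _ _ => dim_pbObj (pl.pl L ι₁)

/-- (Ported verbatim from the HodgeCMPerL package; no docstring in the source.) -/
theorem fact3_lift : (toyModel3With D T pl).Fact_lift := fun _ _ _ f g =>
  ⟨Hom₂.lift f g, Hom₂.lift_comp_fst f g, Hom₂.lift_comp_snd f g⟩

/-- (Ported verbatim from the HodgeCMPerL package; no docstring in the source.) -/
theorem fact3_cup_comm1 : (toyModel3With D T pl).Fact_cup_comm1 := fun _ a b => wedge_comm_one a b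

/-- (Ported verbatim from the HodgeCMPerL package; no docstring in the source.) -/
theorem fact3_cup_interchange : (toyModel3With D T pl).Fact_cup_interchange := fun _ a b c d =>
  wedge_interchange a b c d

/-- (Ported verbatim from the HodgeCMPerL package; no docstring in the source.) -/
theorem fact3_kunneth1 : (toyModel3With D T pl).Fact_kunneth1 := fun X Y =>
  HodgeCM.Toy.fact_kunneth1 D X.X.toObj Y.X.toObj

/-- (Ported verbatim from the HodgeCMPerL package; no docstring in the source.) -/
theorem fact3_H1_rank : (toyModel3With D T pl).Fact_H1_rank := fun K Φ =>
  HodgeCM.Toy.fact_H1_rank D K Φ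

/-- (Ported verbatim from the HodgeCMPerL package; no docstring in the source.) -/
theorem fact3_H4_span : (toyModel3With D T pl).Fact_H4_span := fun _ _ => span_wedge4_eq_top

/-- (Ported verbatim from the HodgeCMPerL package; no docstring in the source.) -/
theorem fact3_cmEnd : (toyModel3With D T pl).Fact_cmEnd := fun K Φ a =>
  ⟨Hom₂.ofHom (mulHom K Φ (a : K)) (isBlockFree_cmObj₂ K Φ), (cmι_apply K Φ (a : K)).symm⟩

/-! ### The CM-specific fields M11, M12, M15, M16, M17, M25 (transported from generation 1) -/

/-- (Ported verbatim from the HodgeCMPerL package; no docstring in the source.) -/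
theorem fact3_eigenLine : (toyModel3With D T pl).Fact_eigenLine := fun K Φ σ =>
  HodgeCM.Toy.fact_eigenLine D K Φ σ

/-- (Ported verbatim from the HodgeCMPerL package; no docstring in the source.) -/
theorem fact3_alphaLine : (toyModel3With D T pl).Fact_alphaLine := fun K Φ σ =>
  HodgeCM.Toy.fact_alphaLine D K Φ σ

/-- (Ported verbatim from the HodgeCMPerL package; no docstring in the source.) -/
theorem fact3_weilLine_rank : (toyModel3With D T pl).Fact_weilLine_rank := fun K Φ =>
  HodgeCM.Toy.fact_weilLine_rank D K Φ

/-- (Ported verbatim from the HodgeCMPerL package; no docstring in the source.) -/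
theorem fact3_weilLine_hodge : (toyModel3With D T pl).Fact_weilLine_hodge := fun K f =>
  HodgeCM.Toy.fact_weilLine_hodge D K f

/-- (Ported verbatim from the HodgeCMPerL package; no docstring in the source.) -/
theorem fact3_conjIsogeny : (toyModel3With D T pl).Fact_conjIsogeny := by
  intro K Φ Φ' h
  obtain ⟨u, hu, hu'⟩ := HodgeCM.Toy.fact_conjIsogeny D K Φ Φ' h
  exact ⟨Hom₂.ofHom u (isBlockFree_cmObj₂ K Φ'), hu, hu'⟩

/-- (Ported verbatim from the HodgeCMPerL package; no docstring in the source.) -/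
theorem fact3_cmDominated (O : GaloisCMOracle) : (toyModel3With D T pl).Fact_cmDominated := by
  rintro X ⟨K, Φ, rfl⟩
  refine ⟨O.F K, O.gal K, O.six K, 0, fun _ => inducedType K (O.F K) (O.emb K) Φ,
    Hom₂.ofHom (sHom K (O.F K) (O.emb K) Φ) (isBlockFree_cmObj₂ _ _),
    Hom₂.ofHom (piHom K (O.F K) (O.emb K) Φ) (isBlockFree_cmObj₂ _ _), 1, one_ne_zero, fun k => ?_⟩
  change map k ((sHom K (O.F K) (O.emb K) Φ).comp (piHom K (O.F K) (O.emb K) Φ)).lin = _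
  rw [sHom_comp_piHom, Nat.cast_one, one_pow, one_smul]
  exact map_id

/-! ### M27 and M28 (transported from `Axioms2`: the fourfold CM products are the same objects) -/

set_option maxHeartbeats 800000 in
/-- (Ported verbatim from the HodgeCMPerL package; no docstring in the source.) -/
theorem fact3_deg_diag : (toyModel3With D T pl).Fact_deg_diag := fun K Φ a M hM k =>
  fact_deg_diag D T pl.pl K Φ a M hM k

set_option maxHeartbeats 800000 in
/-- (Ported verbatim from the HodgeCMPerL package; no docstring in the source.) -/
theorem fact3_algDuality : (toyModel3With exteriorHodgeData T pl).Fact_algDuality := fun K Φ =>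
  fact_algDuality T pl.pl K Φ

/-! ### Assembly: 27 of 28 -/

/-- **27 of the 28 model axioms hold in `toyModel3With exteriorHodgeData T pl`** for every trace system
and every good block assignment; M26 (Gysin for surfaces) is displayed as the one hypothesis. -/
theorem toyModel3_axioms_of (h26 : (toyModel3With exteriorHodgeData T pl).Fact_gysin_surface) :
    (toyModel3With exteriorHodgeData T pl).ModelAxioms where
  pull_id := fact3_pull_id exteriorHodgeData T pl
  pull_comp := fact3_pull_comp exteriorHodgeData T pl
  pull_cup := fact3_pull_cup exteriorHodgeData T pl
  pull_hodge := fact3_pull_hodge exteriorHodgeData T pl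
  cup2_hodge := fact3_cup2_hodge exteriorHodgeData T pl
  tr_degree := fact3_tr_degree exteriorHodgeData T pl
  alg_le_hodge := fact3_alg_le_hodge exteriorHodgeData T pl
  pull_alg := fact3_pull_alg exteriorHodgeData T pl
  cup_alg := fact3_cup_alg exteriorHodgeData T pl
  lefschetz11 := fact3_lefschetz11 exteriorHodgeData T pl
  cmAV := fact3_cmAV exteriorHodgeData T pl
  eigenLine := fact3_eigenLine exteriorHodgeData T pl
  alphaLine := fact3_alphaLine exteriorHodgeData T pl
  cmDominated := fact3_cmDominated exteriorHodgeData T pl galoisCMOracle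
  weilLine_rank := fact3_weilLine_rank exteriorHodgeData T pl
  weilLine_hodge := fact3_weilLine_hodge exteriorHodgeData T pl
  pms_dim := fact3_pms_dim exteriorHodgeData T pl
  lift := fact3_lift exteriorHodgeData T pl
  cup_comm1 := fact3_cup_comm1 exteriorHodgeData T pl
  cup_interchange := fact3_cup_interchange exteriorHodgeData T pl
  kunneth1 := fact3_kunneth1 exteriorHodgeData T pl
  H1_rank := fact3_H1_rank exteriorHodgeData T pl
  H4_span := fact3_H4_span exteriorHodgeData T pl
  cmEnd := fact3_cmEnd exteriorHodgeData T pl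
  conjIsogeny := fact3_conjIsogeny exteriorHodgeData T pl
  gysin_surface := h26
  deg_diag := fact3_deg_diag exteriorHodgeData T pl
  algDuality := fact3_algDuality T pl

/-! ### The universe on the period leaves -/

section periodLeaves

variable (d t : ℚ)

/-- the good block assignment `(L, ι₁) ↦ P(L, ι₁)` (good by `good_pLeafOf`) -/
def gplOf : GBlocks := ⟨plOf d t, fun L ι₁ => good_pLeafOf L ι₁ d t⟩

/-- **the generation-2 universe on good objects, with the period leaves as Picard modular surfaces** -/
abbrev toyUniverse₃ : Universe := toyModel3With exteriorHodgeData traceSys (gplOf d t)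

/-- 27 of 28: `ModelAxioms` for `toyUniverse₃ d t`, given Gysin for surfaces -/
theorem toyUniverse₃_modelAxioms_of_gysin (h : (toyUniverse₃ d t).Fact_gysin_surface) :
    (toyUniverse₃ d t).ModelAxioms :=
  toyModel3_axioms_of traceSys (gplOf d t) h

/-- the period surface at `(L, ι₁)` is the (good) block object on `P(L, ι₁)` -/
theorem toyUniverse₃_pms_X (L : CMField) (ι₁ : L →+* ℂ) (V : HermSpace3 L ι₁) (Γ : Level V) :
    ((toyUniverse₃ d t).pms L ι₁ V Γ).X = pbObj (pLeafOf L ι₁ d t) := rfl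

/-- its degree-4 trace is the period functional `ℓ` of `P(L, ι₁)` … -/
theorem toyUniverse₃_tr_pms (L : CMField) (ι₁ : L →+* ℂ) (V : HermSpace3 L ι₁) (Γ : Level V) :
    (toyUniverse₃ d t).tr ((toyUniverse₃ d t).pms L ι₁ V Γ) 4 = (pLeafOf L ι₁ d t).ℓ :=
  toyUniverse₂_tr_pms d t L ι₁ V Γ

/-- … which is nonzero -/
theorem toyUniverse₃_tr_pms_ne_zero (L : CMField) (ι₁ : L →+* ℂ) (V : HermSpace3 L ι₁) (Γ : Level V) :
    (toyUniverse₃ d t).tr ((toyUniverse₃ d t).pms L ι₁ V Γ) 4 ≠ 0 := by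
  rw [toyUniverse₃_tr_pms]; exact pLeafOf_ℓ_ne_zero L ι₁ d t

/-- every variety of `toyUniverse₃ d t` is good; in particular the `NoGysin` witness
`P × zeroBlock P` is not a variety of this universe -/
theorem toyUniverse₃_good (X : (toyUniverse₃ d t).Var) : X.X.Good := X.good

/-- (Ported verbatim from the HodgeCMPerL package; no docstring in the source.) -/
theorem toyUniverse₃_no_zeroBlock (X : (toyUniverse₃ d t).Var) (u : X.X.s.toType) (P : PLeaf) :
    X.X.leaf u ≠ Leaf.pb (zeroBlock P) := fun h =>
  not_good_zeroBlock P (h ▸ X.good u)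

end periodLeaves

end

end HodgeCM.ToyG2
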